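import Summits.QuantumFields.GaugeBoot.DiagonalRPTorusLadderLinks
import HarnessLib

/-!
# The ladder integral of two adjacent Polyakov loops (gauge-boot, task L3(ξ))

HONEST FRAMING (cell `pub-gaugeboot`, page 1 of every file): the venture produces certified bounds
on lattice expectations at stated coupling, gauge group, dimension and torus size; NOT a mass gap,
NOT a continuum limit, NOT a string tension; NOT Yang–Mills-summit-bearing (barriers
`FixedCouplingUltralocality`, `PerturbativeInvisibility`). This module computes the LEADING
strong-coupling coefficient used by the structural NEGATIVE result `DiagonalRPTorusNegativeOddSUN`
(closed-half diagonal RP fails on odd three-tori for `G ≅ SU(N)` at small coupling); it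
discharges nothing by itself.

## Content (torus `(ℤ/L)³`, spectator direction `2`, any compact metrisable `G`, continuous `ρ`)

For a column `B ∈ (ℤ/L)²`, a vertical coordinate plane `pl = (a, 2)` and the adjacent column
`A = B + e_a`, the LADDER INTEGRAL is
`I(A, B) = ∫ P_A(U) P_B(U) ∏_{z ∈ ℤ/L} Re tr ρ(U_{p_z}) ∏ dU`,
`P` the real Polyakov loops (`DiagRPPolyakov.polRe ρ 2`) and `p_z = (vsite B z, pl)` the rung
plaquettes. Under the two CHARACTER IDENTITIES (hypotheses here; theorems for `G ≅ SU(N)` in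
`DiagonalRPTorusCharacterMoments`)
* (R1) `∫ Re χ(x g⁻¹) Re χ(g y) dg = c₁ Re χ(x y)`,
* (R2) `∫ Re χ(g x g⁻¹ y) dg = c₂ Re(χ(x) χ(y))`,
**`ladderIntegral_eq`**: `I(A, B) = c₁^{L-1} c₂ (V₀² + V₁²)` with `V₀ = ∫ (Re χ)²`
(`PlaquetteLowerBound.charVariance`) and `V₁ = ∫ Re χ Im χ`; hence
**`ladderIntegral_pos`**: `I(A, B) ≥ c₁^{L-1} c₂ V₀² > 0` when `c₁, c₂ > 0`, `N ≥ 1`.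
Mechanism: resample the rungs `r_1, …, r_{L-1}` one at a time with (R1) (`stage_succ`, the word
`𝔅_k⁻¹ r_0 𝔄_k r_k⁻¹` growing by one height per step), then `r_0` with (R2), then the bottom
links of the two columns with right invariance of Haar measure (`DiagRPSUN.integral_pi_update`).

Elementary strong-coupling bookkeeping (cf. M. Creutz, *Quarks, gluons and lattices* (1983)
§10); not in print in this form as far as the cell's searches go.
-/

open MeasureTheory Complex Finset Function
open scoped ComplexOrder

namespace Summit.QuantumFields.GaugeBoot

open Literature.MathematicalPhysics.QuantumFieldTheory
open Literature.MathematicalPhysics.QuantumFieldTheory.PlaquetteLowerBound (reTr charVariance)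
open Literature.RepresentationTheory.CompactGroups

noncomputable section

namespace DiagRPSUN

open DiagRPThree DiagRPPolyakov

/-! ## The stage integrands -/

section Ladder

variable {L : ℕ} [NeZero L] {N : ℕ} {G : Type*} [Group G] [TopologicalSpace G]
  [IsTopologicalGroup G] [CompactSpace G] [MeasurableSpace G] [BorelSpace G]
  [SecondCountableTopology G] (ρ : G →* Matrix (Fin N) (Fin N) ℂ)
  (pl : {q : Fin 3 × Fin 3 // q.1 < q.2}) (B : ZMod L × ZMod L)

/-- The column holonomy of the first `n` vertical links over `A`: `a_0 a_1 ⋯ a_{n-1}`. -/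
def colHol (A : ZMod L × ZMod L) (n : ℕ) (U : GaugeConfig 3 L G) : G :=
  lineHolonomy U 2 n (vsite A 0)

/-- The stage-`k` word `𝔅_k⁻¹ r_0 𝔄_k r_k⁻¹` (`A = B + e_a`, `r_z = U(vsite B z, a)`). -/
def ladderWord (k : ℕ) (U : GaugeConfig 3 L G) : G :=
  (colHol B k U)⁻¹ * U (vsite B 0, pl.1.1) * colHol (bump pl.1.1 B) k U *
    (U (vsite B (k : ZMod L), pl.1.1))⁻¹

/-- The stage-`k` integrand `P_A P_B · Re χ(𝔅_k⁻¹ r_0 𝔄_k r_k⁻¹) · ∏_{k ≤ i < L} Re tr ρ(U_{p_i})`. -/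
def stageIntegrand (k : ℕ) (U : GaugeConfig 3 L G) : ℝ :=
  polRe ρ 2 U (vsite (bump pl.1.1 B) 0) * polRe ρ 2 U (vsite B 0) * reTr ρ (ladderWord pl B k U) *
    ∏ i ∈ Ico k L, WilsonRP.plaqRe ρ U (vsite B (i : ZMod L), pl)

/-- The LADDER INTEGRAL `I(A,B) = ∫ P_A P_B ∏_z Re tr ρ(U_{p_z}) ∏ dU`. -/
def ladderIntegral : ℝ :=
  ∫ U, polRe ρ 2 U (vsite (bump pl.1.1 B) 0) * polRe ρ 2 U (vsite B 0) *
    ∏ z : ZMod L, WilsonRP.plaqRe ρ U (vsite B z, pl) ∂Measure.pi fun _ : Edge 3 L => haarProbability G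

/-- `V₁ = ∫ Re χ · Im χ`, the mixed second moment of the character. -/
def charMixed : ℝ := ∫ g, reTr ρ g * ((ρ g).trace).im ∂haarProbability G

/-! ### Continuity and integrability -/

omit [NeZero L] [TopologicalSpace G] [IsTopologicalGroup G] [CompactSpace G] [MeasurableSpace G]
  [BorelSpace G] [SecondCountableTopology G] in
/-- Growing the column by one link: `𝔄_{k+1} = 𝔄_k a_k`. -/
theorem colHol_succ (A : ZMod L × ZMod L) (k : ℕ) (U : GaugeConfig 3 L G) :
    colHol A (k + 1) U = colHol A k U * U (vsite A (k : ZMod L), 2) := by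
  unfold colHol
  rw [WilsonLoopRP.lineHolonomy_succ_right, vsite_add_single_two, zero_add]

omit [NeZero L] [IsTopologicalGroup G] [CompactSpace G] [MeasurableSpace G] [BorelSpace G]
  [SecondCountableTopology G] in
/-- Line holonomies are continuous in the configuration. -/
theorem continuous_lineHolonomy [ContinuousMul G] (k : Fin 3) :
    ∀ (n : ℕ) (y : Site 3 L), Continuous fun U : GaugeConfig 3 L G => lineHolonomy U k n y
  | 0, y => by simpa [lineHolonomy] using continuous_const
  | n + 1, y => (continuous_apply _).mul (continuous_lineHolonomy k n _)

/-- A continuous function on the (compact) configuration space is integrable for the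
product Haar measure. -/
theorem integrable_of_continuous_config {E : Type*} [NormedAddCommGroup E]
    {F : GaugeConfig 3 L G → E} (hF : Continuous F) :
    Integrable F (Measure.pi fun _ : Edge 3 L => haarProbability G) := by
  obtain ⟨C, hC⟩ := isCompact_univ.exists_bound_of_continuousOn hF.continuousOn
  exact Integrable.of_bound hF.aestronglyMeasurable C
    (ae_of_all _ fun U => hC U (Set.mem_univ _))

omit [NeZero L] [IsTopologicalGroup G] [MeasurableSpace G] [BorelSpace G] [SecondCountableTopology G]
  [CompactSpace G] in
/-- `Re χ` of a continuous configuration functional is continuous. -/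
theorem continuous_reTr_comp (hρ : Continuous ρ) {f : GaugeConfig 3 L G → G} (hf : Continuous f) :
    Continuous fun U => reTr ρ (f U) :=
  Complex.continuous_re.comp (hρ.matrix_trace.comp hf)

omit [NeZero L] [MeasurableSpace G] [BorelSpace G] [SecondCountableTopology G] [CompactSpace G] in
/-- A plaquette value is continuous in the configuration. -/
theorem continuous_plaqRe (hρ : Continuous ρ) (p : Plaquette 3 L) :
    Continuous fun U : GaugeConfig 3 L G => WilsonRP.plaqRe ρ U p := by
  have h1 := continuous_apply (A := fun _ : Edge 3 L => G) (p.1, p.2.1.1)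
  have h2 := continuous_apply (A := fun _ : Edge 3 L => G) (p.1.shift p.2.1.1, p.2.1.2)
  have h3 := continuous_apply (A := fun _ : Edge 3 L => G) (p.1.shift p.2.1.2, p.2.1.1)
  have h4 := continuous_apply (A := fun _ : Edge 3 L => G) (p.1, p.2.1.2)
  unfold WilsonRP.plaqRe plaquetteHolonomy
  exact Complex.continuous_re.comp (hρ.matrix_trace.comp (((h1.mul h2).mul h3.inv).mul h4.inv))

omit [NeZero L] [MeasurableSpace G] [BorelSpace G] [SecondCountableTopology G] [CompactSpace G] in
/-- The stage integrand is continuous. -/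
theorem continuous_stageIntegrand (hρ : Continuous ρ) (k : ℕ) :
    Continuous (stageIntegrand ρ pl B k) := by
  unfold stageIntegrand
  refine ((((continuous_polRe ρ hρ 2 _).mul (continuous_polRe ρ hρ 2 _)).mul
    (continuous_reTr_comp ρ hρ ?_)).mul (continuous_finsetProd _ fun i _ =>
      continuous_plaqRe ρ hρ _))
  unfold ladderWord colHol
  have hr0 := continuous_apply (A := fun _ : Edge 3 L => G) (vsite B 0, pl.1.1)
  have hrk := continuous_apply (A := fun _ : Edge 3 L => G) (vsite B (k : ZMod L), pl.1.1)
  exact ((((continuous_lineHolonomy 2 k _).inv).mul hr0).mul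
    (continuous_lineHolonomy 2 k _)).mul hrk.inv

/-! ### Stage `1` is the ladder integral -/

omit [TopologicalSpace G] [IsTopologicalGroup G] [CompactSpace G] [MeasurableSpace G] [BorelSpace G]
  [SecondCountableTopology G] in
/-- `∏_{z ∈ ℤ/L} φ_z = φ_0 · ∏_{1 ≤ i < L} φ_i` and `Re χ(word₁) = φ_0`: the ladder integrand is
the stage-`1` integrand. -/
theorem stageIntegrand_one (hpl : pl.1.2 = 2) (U : GaugeConfig 3 L G) :
    stageIntegrand ρ pl B 1 U = polRe ρ 2 U (vsite (bump pl.1.1 B) 0) * polRe ρ 2 U (vsite B 0) *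
      ∏ z : ZMod L, WilsonRP.plaqRe ρ U (vsite B z, pl) := by
  have hL : 0 < L := NeZero.pos L
  have hprod : ∏ z : ZMod L, WilsonRP.plaqRe ρ U (vsite B z, pl) =
      WilsonRP.plaqRe ρ U (vsite B 0, pl) *
        ∏ i ∈ Ico 1 L, WilsonRP.plaqRe ρ U (vsite B (i : ZMod L), pl) := by
    rw [← prod_range_natCast, range_eq_Ico, prod_eq_prod_Ico_succ_bot hL, Nat.cast_zero]
  have hword : reTr ρ (ladderWord pl B 1 U) = WilsonRP.plaqRe ρ U (vsite B 0, pl) := by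
    rw [plaqRe_rung ρ pl hpl B U 0, zero_add]
    unfold ladderWord colHol
    simp only [lineHolonomy, mul_one, Nat.cast_one]
    rw [show (U (vsite B 0, 2))⁻¹ * U (vsite B 0, pl.1.1) * U (vsite (bump pl.1.1 B) 0, 2) *
        (U (vsite B 1, pl.1.1))⁻¹ = (U (vsite B 0, 2))⁻¹ * (U (vsite B 0, pl.1.1) *
          U (vsite (bump pl.1.1 B) 0, 2) * (U (vsite B 1, pl.1.1))⁻¹) by group, reTr_mul_comm]
  unfold stageIntegrand
  rw [hword, hprod]
  ring

omit [SecondCountableTopology G] in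
/-- **`I(A,B) = J₁`.** -/
theorem ladderIntegral_eq_stage_one (hpl : pl.1.2 = 2) :
    ladderIntegral ρ pl B = ∫ U, stageIntegrand ρ pl B 1 U
      ∂Measure.pi fun _ : Edge 3 L => haarProbability G := by
  unfold ladderIntegral
  exact integral_congr_ae (ae_of_all _ fun U => (stageIntegrand_one ρ pl B hpl U).symm)

/-! ### The inductive step: resampling the rung `r_k` with (R1) -/

/-- **Stage step.** For `1 ≤ k < L`, resampling the rung `r_k = U(vsite B k, a)` with the
convolution identity (R1) turns the stage-`k` integrand into `c₁` times the stage-`(k+1)`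
integrand: `J_k = c₁ J_{k+1}`. -/
theorem stage_succ (hpl : pl.1.2 = 2) (hρ : Continuous ρ) {c₁ : ℝ}
    (hR1 : ∀ x y : G, ∫ g, reTr ρ (x * g⁻¹) * reTr ρ (g * y) ∂haarProbability G =
      c₁ * reTr ρ (x * y))
    {k : ℕ} (hk1 : 1 ≤ k) (hkL : k < L) :
    ∫ U, stageIntegrand ρ pl B k U ∂Measure.pi (fun _ : Edge 3 L => haarProbability G) =
      c₁ * ∫ U, stageIntegrand ρ pl B (k + 1) U
        ∂Measure.pi (fun _ : Edge 3 L => haarProbability G) := by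
  have hL1 : 1 < L := by omega
  have ha := fst_ne_two pl hpl
  set a : Fin 3 := pl.1.1 with ha_def
  set A := bump a B with hA
  set e : Edge 3 L := (vsite B (k : ZMod L), a) with he
  -- casts of the heights involved
  have hk0 : (k : ZMod L) ≠ 0 := fun h => by
    have := (natCast_eq_natCast_iff_of_lt hkL (NeZero.pos L)).1 (by rw [h, Nat.cast_zero])
    omega
  have hk1' : ((k + 1 : ℕ) : ZMod L) ≠ (k : ZMod L) := natCast_succ_ne hL1 k
  rw [← integral_const_mul]
  refine integral_pi_update_of_forall (haarProbability G) e
    (integrable_of_continuous_config (continuous_stageIntegrand ρ pl B hρ k)) fun U => ?_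
  -- the pieces of the stage-`k` integrand at the updated configuration
  set x : G := (colHol B k U)⁻¹ * U (vsite B 0, a) * colHol A k U with hx
  set y : G := U (vsite A (k : ZMod L), 2) * (U (vsite B ((k : ZMod L) + 1), a))⁻¹ *
    (U (vsite B (k : ZMod L), 2))⁻¹ with hy
  set R : ℝ := polRe ρ 2 U (vsite A 0) * polRe ρ 2 U (vsite B 0) *
    ∏ i ∈ Ico (k + 1) L, WilsonRP.plaqRe ρ U (vsite B (i : ZMod L), pl) with hR
  have hP : ∀ (C : ZMod L × ZMod L) (s : G), polRe ρ 2 (update U e s) (vsite C 0) =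
      polRe ρ 2 U (vsite C 0) := fun C s => by
    unfold polRe
    rw [lineHolonomy_update_of_snd_ne_two ha]
  have hcol : ∀ (C : ZMod L × ZMod L) (s : G), colHol C k (update U e s) = colHol C k U :=
    fun C s => by unfold colHol; rw [lineHolonomy_update_of_snd_ne_two ha]
  have hr0 : ∀ s : G, update U e s (vsite B 0, a) = U (vsite B 0, a) := fun s =>
    update_of_ne (fun h => hk0 (vsite_eq_vsite_iff.1 (congrArg Prod.fst h)).2.symm) _ _
  have hword : ∀ s : G, ladderWord pl B k (update U e s) = x * s⁻¹ := fun s => by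
    unfold ladderWord
    rw [hcol, hcol, hr0, ← he, update_self]
  have hprodsplit : ∀ V : GaugeConfig 3 L G,
      ∏ i ∈ Ico k L, WilsonRP.plaqRe ρ V (vsite B (i : ZMod L), pl) =
        WilsonRP.plaqRe ρ V (vsite B (k : ZMod L), pl) *
          ∏ i ∈ Ico (k + 1) L, WilsonRP.plaqRe ρ V (vsite B (i : ZMod L), pl) := fun V =>
    prod_eq_prod_Ico_succ_bot hkL _
  have hrest : ∀ s : G, ∏ i ∈ Ico (k + 1) L, WilsonRP.plaqRe ρ (update U e s) (vsite B (i : ZMod L), pl)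
      = ∏ i ∈ Ico (k + 1) L, WilsonRP.plaqRe ρ U (vsite B (i : ZMod L), pl) := fun s => by
    refine prod_congr rfl fun i hi => ?_
    obtain ⟨hik, hiL⟩ := mem_Ico.1 hi
    refine plaqRe_rung_update_horizontal ρ pl hpl B ?_ ?_
    · exact fun h => by
        have := (natCast_eq_natCast_iff_of_lt hkL hiL).1 h
        omega
    · intro h
      rw [← Nat.cast_add_one] at h
      rcases Nat.lt_or_ge (i + 1) L with hi1 | hi1
      · have := (natCast_eq_natCast_iff_of_lt hkL hi1).1 h
        omega
      · have hiL' : i + 1 = L := by omega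
        rw [hiL', ZMod.natCast_self] at h
        exact hk0 h
  have hrung : ∀ s : G, WilsonRP.plaqRe ρ (update U e s) (vsite B (k : ZMod L), pl) =
      reTr ρ (s * y) := fun s => by
    rw [plaqRe_rung ρ pl hpl, ← ha_def, ← hA, ← he, update_self,
      update_of_ne (fun h => (show (2 : Fin 3) ≠ a from ha.symm) (congrArg Prod.snd h)),
      update_of_ne (fun h => hk1' (by
        have h' := (vsite_eq_vsite_iff.1 (congrArg Prod.fst h)).2
        rw [← Nat.cast_add_one] at h'
        exact h')),
      update_of_ne (fun h => (show (2 : Fin 3) ≠ a from ha.symm) (congrArg Prod.snd h)), hy]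
    exact congrArg (reTr ρ) (by group)
  have hF : ∀ s : G, stageIntegrand ρ pl B k (update U e s) =
      R * (reTr ρ (x * s⁻¹) * reTr ρ (s * y)) := fun s => by
    unfold stageIntegrand
    rw [hprodsplit, hrest, hrung, hword, ← hA, hP, hP, hR]
    ring
  simp_rw [hF]
  rw [integral_const_mul, hR1 x y]
  -- identify `Re χ(x y)` with the stage-`(k+1)` word
  have hword' : reTr ρ (x * y) = reTr ρ (ladderWord pl B (k + 1) U) := by
    unfold ladderWord
    rw [colHol_succ, colHol_succ, Nat.cast_add_one, ← ha_def, ← hA]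
    rw [show (colHol B k U * U (vsite B (k : ZMod L), 2))⁻¹ * U (vsite B 0, a) *
        (colHol A k U * U (vsite A (k : ZMod L), 2)) * (U (vsite B ((k : ZMod L) + 1), a))⁻¹ =
        (U (vsite B (k : ZMod L), 2))⁻¹ * (x * (U (vsite A (k : ZMod L), 2) *
          (U (vsite B ((k : ZMod L) + 1), a))⁻¹)) by rw [hx]; group,
      reTr_mul_comm ρ (U (vsite B (k : ZMod L), 2))⁻¹, hy]
    exact congrArg (reTr ρ) (by group)
  unfold stageIntegrand
  rw [hword', hR, ← hA]
  ring

/-- **Iterating the stage step**: `J_1 = c₁^{L-1} J_L`. -/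
theorem stage_one_eq (hpl : pl.1.2 = 2) (hρ : Continuous ρ) {c₁ : ℝ}
    (hR1 : ∀ x y : G, ∫ g, reTr ρ (x * g⁻¹) * reTr ρ (g * y) ∂haarProbability G =
      c₁ * reTr ρ (x * y)) :
    ∫ U, stageIntegrand ρ pl B 1 U ∂Measure.pi (fun _ : Edge 3 L => haarProbability G) =
      c₁ ^ (L - 1) * ∫ U, stageIntegrand ρ pl B L U
        ∂Measure.pi (fun _ : Edge 3 L => haarProbability G) := by
  have key : ∀ m : ℕ, m + 1 ≤ L →
      ∫ U, stageIntegrand ρ pl B 1 U ∂Measure.pi (fun _ : Edge 3 L => haarProbability G) =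
        c₁ ^ m * ∫ U, stageIntegrand ρ pl B (m + 1) U
          ∂Measure.pi (fun _ : Edge 3 L => haarProbability G) := by
    intro m
    induction m with
    | zero => intro _; simp
    | succ m ih =>
      intro hm
      rw [ih (by omega), stage_succ ρ pl B hpl hρ hR1 (by omega) (by omega), pow_succ, mul_assoc]
  have h := key (L - 1) (by have := NeZero.pos L; omega)
  rwa [Nat.sub_add_cancel (NeZero.pos L)] at h

end Ladder

end DiagRPSUN

end

end Summit.QuantumFields.GaugeBoot
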